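import Literature.Analysis.FluidPDE.NSLocalLerayFarFieldVorticityBypass
import Literature.Analysis.FluidPDE.NSBoundedHigherRegularityQuantProofs
import HarnessLib

/-!
# Lemarié-Rieusset 2016, Thm. 15.4 on a slab, discharged without weak–strong uniqueness:
# far-field backward uniqueness, partial regularity, and unique continuation at regular times

Analysis/FluidPDE proof file (theorems only: no definition, no named fact, no `sorry`). It
**discharges the named fact** `Literature.Analysis.FluidPDE.lemarieRieusset_backward_uniqueness_slab`
(`NSSereginMildFacts.lean`; P. G. Lemarié-Rieusset, *The Navier–Stokes Problem in the 21st
Century* (2016), doi:10.1201/b19556, **Thm. 15.4**, PDF p. 568: a local Leray solution on a slab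
`(0, T) × ℝ³` with divergence-free datum `u₀ ∈ L³` whose value at the final time vanishes is
identically zero), and with it the global-class form `lemarieRieusset_backward_uniqueness`
(`NSLerayHopfSereginLiminf.lean`, through the accepted `lemarieRieusset_backward_uniqueness_of_slab`).

## The proof (Escauriaza–Seregin–Šverák's route; no weak–strong uniqueness)

The accepted reductions of Thm. 15.4 in the tree (`lemarieRieusset_backward_uniqueness_slab_of_UC`,
`…_of_U_S`) follow the printed proof, whose Step 1 identifies the local Leray solution near
`t = 0` with Kato's mild solution by the weak–strong uniqueness theorem **U** (Thm. 14.7,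
`local_leray_weak_strong_uniqueness`, an unproved named fact). This file replaces Step 1 and the
final appeal to U by the argument of Escauriaza–Seregin–Šverák 2003, §5 (proof of Thm. 1.3/1.4)
= Seregin, Comm. Math. Phys. 312 (2012), §4 = Seregin 2014, Ch. 7 p. 139, all of whose inputs are
theorems of the tree:

1. **Far field** (Steps 2–3 of the printed proof, a theorem of the tree:
   `localLeray_farField_vorticity_eq_zero_slab_of_higherRegularityBounds
   NSBoundedHigherRegularityBounds_holds`): for every `T₄ ∈ (0, T)` there are `R` and a
   representative `U_f` of `u` on `(T₄, T) × {x₃ > R}`, `C¹` in space, with `curl U_f = 0` there;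
   and `u` is essentially bounded on `(T₄, T) × {|x| > R_b}`
   (`leray_solution_farField_bound_slab_holds`, Thm. 14.5).
2. **Regular times** (Caffarelli–Kohn–Nirenberg, Thm. B, `ckn_partial_regularity_holds`): the
   singular set of the suitable weak solution `(u, p)` on the open slab is `𝒫¹`-null, so its set
   of times is Lebesgue-null (`volume_image_fst_eq_zero_of_isParabolicNull`): for a.e.
   `t ∈ (0, T)` every `(t, x)` is a regular point (`ae_forall_isRegularPoint_slab`).
3. **Bounded strips** (ESS 2003, §3/§5, interior step): a regular slice `{t} × B̄(0, R_b + 1)` is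
   covered by finitely many cylinders of essential boundedness, which together with the far-field
   bound give `|u| ≤ L` a.e. on a full strip `(t - τ, t + τ) × ℝ³` (`exists_strip_bound_Ioo`).
4. **Smooth representative on the strip** with bounded spatial derivatives up to order `4`
   (Serrin's interior regularity in the quantitative form `NSBoundedHigherRegularityBounds_holds`
   with Kang–Miura–Tsai's local pressure bound `kangMiuraTsai_local_pressure_bound_holds`; the
   tree's `exists_farField_representative_unit` applied with an empty excluded ball).
5. **Unique continuation** (ESS 2003, Thm. 4.1, in the class `C¹ ∩ {∂ₓω ∈ C¹}` of the vorticity of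
   the representative, `Carleman.uniqueContinuation_uncurried_c12`, with the differential
   inequality `|∂ₜω - Δω| ≤ 2K(|ω| + |∇ω|)`, `vorticity_carleman_inequality`): the vorticity of the
   representative vanishes on the far half-space at every time of the strip, hence on every ball,
   i.e. identically.
6. **Liouville**: a bounded `C²` field on `ℝ³` with `curl = 0`, `div = 0` is constant
   (`eq_of_curl_eq_zero_of_isDivFree_of_bounded`); the decay of the local Leray class at spatial
   infinity (Kang–Miura–Tsai's clause (7)) forces the constant to vanish for a.e. time of the
   strip. Hence `u = 0` a.e. on the strip (`ae_zero_strip_of_farField_curl_eq_zero`).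
7. **Assembly**: a.e. time in `(T₄, T)` lies in such a strip; countably many strips (rational
   end points) cover them, so `u = 0` a.e. on `(T₄, T) × ℝ³` for every `T₄ > 0`, i.e. on the
   slab (`IsLocalLeraySolutionOn.ae_zero_of_final_vanishing_unit`); the statement for viscosity
   `ν > 0` follows by the scaling `t ↦ νt` of the slab class
   (`IsLocalLeraySolutionOn.toUnitViscosity`, `ae_restrict_preimage_stAffine`).

Main results:

* `ae_forall_isRegularPoint_slab`, `exists_strip_bound_Ioo` (steps 2–3);
* `ae_zero_strip_of_farField_curl_eq_zero` (steps 4–6);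
* `IsLocalLeraySolutionOn.ae_zero_of_final_vanishing_unit`, `…_of_final_vanishing` (step 7);
* `lemarieRieusset_backward_uniqueness_slab_holds`, `lemarieRieusset_backward_uniqueness_holds`.

Nothing accepted is restated or changed; the two named facts keep their statements.

## Mathlib / tree search

Tree (all proved, used by name): `ckn_partial_regularity_holds` (`PartialRegularityHolds`),
`volume_image_fst_eq_zero_of_isParabolicNull`, `exists_strip_bound_of_forall_isRegularPoint`
(`ESSLocalHolderNoConcentration`), `exists_farField_representative_unit`
(`NSLocalLerayFarFieldRegularSlabProofs`), `vorticity_c12_of_isDistributionalNSSolutionOn`,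
`vorticity_carleman_inequality` (`ESSLocalHolderVorticityC12`),
`Carleman.uniqueContinuation_uncurried_c12` (`CarlemanRegularityC12`), `Carleman.*_comp_stAffine`
(`BackwardUniquenessRescale`), `eq_of_curl_eq_zero_of_isDivFree_of_bounded` (`CurlFreeLiouville`),
`localLeray_farField_vorticity_eq_zero_slab_of_higherRegularityBounds`
(`NSLocalLerayFarFieldVorticityBypass`), `leray_solution_farField_bound_slab_holds`
(`LerayFarFieldRegularityHolds`), `NSBoundedHigherRegularityBounds_holds`,
`kangMiuraTsai_local_pressure_bound_holds`, `IsLocalLeraySolutionOn.toUnitViscosity`,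
`timeRescale_timeRescale_inv` (`LocalLeraySlabViscosityScaling`), `ae_restrict_preimage_stAffine`,
`stAffine_preimage_Ioo_zero_prod` (`SpaceTimeRescaling`), `lemarieRieusset_backward_uniqueness_of_slab`
(`NSSereginMildFacts`). `lean search 'lemarieRieusset_backward_uniqueness_slab_holds|
lemarieRieusset_backward_uniqueness_holds'`: only docstring mentions (2026-08-15).

## References

* P. G. Lemarié-Rieusset, *The Navier–Stokes Problem in the 21st Century*, CRC Press (2016),
  doi:10.1201/b19556: Thm. 15.4 (PDF p. 568) and its proof (pp. 568–569); Thm. 14.5 (p. 510).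
  [`LemarieRieusset2016`]
* L. Escauriaza, G. Seregin, V. Šverák, *`L_{3,∞}`-solutions of Navier–Stokes equations and
  backward uniqueness*, Russ. Math. Surveys 58:2 (2003) 211–250: §3 (interior step after (3.32)),
  Thm. 4.1, Thm. 5.1, §5. [`EscauriazaSereginSverak2003`]
* G. Seregin, *A certain necessary condition of potential blow up for Navier–Stokes equations*,
  Comm. Math. Phys. 312 (2012) 833–845 = arXiv:1104.3615, §4. [`Seregin2012CMP`]
* G. Seregin, *Lecture Notes on Regularity Theory for the Navier–Stokes Equations* (2014),
  Ch. 7 p. 139. [`Seregin2014`]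
* L. Caffarelli, R. Kohn, L. Nirenberg, Comm. Pure Appl. Math. 35 (1982), Thm. B. [`CKN1982`]
-/

noncomputable section

open MeasureTheory TopologicalSpace Set Function Filter Metric
open _root_.Topology
open scoped ENNReal NNReal InnerProductSpace RealInnerProductSpace

namespace Literature.Analysis.FluidPDE

/-! ### Step 2: almost every time of a suitable weak solution on a slab is regular -/

/-- **Almost every time is regular, slab form** (Caffarelli–Kohn–Nirenberg 1982, Thm. B, through
`ckn_partial_regularity_holds`; ESS 2003, §3; Seregin 2014, Ch. 7 p. 139): for a suitable weak
solution of the unforced equations with viscosity `ν > 0` on the open slab `(0, T) × ℝ³`, for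
a.e. `t ∈ (0, T)` every point `(t, x)` is a regular point. [cite: CKN1982, Theorem B] [cite: Seregin2014, Ch. 7 p. 139] -/
theorem ae_forall_isRegularPoint_slab {T ν : ℝ} (hν : 0 < ν)
    {v : ℝ → EuclideanSpace ℝ (Fin 3) → EuclideanSpace ℝ (Fin 3)}
    {π : ℝ → EuclideanSpace ℝ (Fin 3) → ℝ}
    (hv : IsSuitableWeakSolutionOn
      (slab (EuclideanSpace ℝ (Fin 3)) (Ioo 0 T) isOpen_Ioo) ν 0 v π) :
    ∀ᵐ t ∂(volume.restrict (Ioo 0 T)), ∀ x : EuclideanSpace ℝ (Fin 3), IsRegularPoint v (t, x) := by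
  have hnull : IsParabolicNull 1 (singularSet v
      ((slab (EuclideanSpace ℝ (Fin 3)) (Ioo 0 T) isOpen_Ioo : Opens (ℝ × EuclideanSpace ℝ (Fin 3))) :
        Set (ℝ × EuclideanSpace ℝ (Fin 3)))) :=
    ckn_partial_regularity_holds _ hν hv (isCKNForceOn_zero _)
  have hN := volume_image_fst_eq_zero_of_isParabolicNull hnull
  have hae : ∀ᵐ t ∂(volume : Measure ℝ), t ∉ Prod.fst '' singularSet v
      ((slab (EuclideanSpace ℝ (Fin 3)) (Ioo 0 T) isOpen_Ioo : Opens (ℝ × EuclideanSpace ℝ (Fin 3))) :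
        Set (ℝ × EuclideanSpace ℝ (Fin 3))) :=
    measure_eq_zero_iff_ae_notMem.1 hN
  filter_upwards [ae_restrict_mem measurableSet_Ioo, ae_restrict_of_ae hae] with t ht htN x
  by_contra hreg
  exact htN ⟨(t, x), ⟨mem_slab.2 ht, hreg⟩, rfl⟩

/-! ### Step 3: a bounded strip around a regular time -/

/-- **A bounded strip around a regular time, forward-time form** (ESS 2003, §3, interior step;
Seregin 2014, Ch. 7 p. 139): if `|w| ≤ M` a.e. on the far field `(T₄, T) × {|x| > R₀}` and every
point of `{t} × B̄(0, R₀ + 1)` is regular, `T₄ < t < T`, then `|w| ≤ L` a.e. on a full strip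
`(t - τ, t + τ) × ℝ³ ⊆ (T₄, T) × ℝ³`. [cite: Seregin2014, Ch. 7 p. 139] [cite: EscauriazaSereginSverak2003, §3 after (3.32)] -/
theorem exists_strip_bound_Ioo {w : ℝ → EuclideanSpace ℝ (Fin 3) → EuclideanSpace ℝ (Fin 3)}
    {T₄ T R₀ M t : ℝ}
    (hfar : ∀ᵐ z ∂(volume.restrict (Ioo T₄ T ×ˢ (closedBall (0 : EuclideanSpace ℝ (Fin 3)) R₀)ᶜ)),
      ‖w z.1 z.2‖ ≤ M)
    (h : ∀ x ∈ closedBall (0 : EuclideanSpace ℝ (Fin 3)) (R₀ + 1), IsRegularPoint w (t, x))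
    (ht : t ∈ Ioo T₄ T) :
    ∃ τ : ℝ, 0 < τ ∧ Ioo (t - τ) (t + τ) ⊆ Ioo T₄ T ∧ ∃ L : ℝ,
      ∀ᵐ z ∂(volume.restrict (Ioo (t - τ) (t + τ) ×ˢ (univ : Set (EuclideanSpace ℝ (Fin 3))))),
        ‖w z.1 z.2‖ ≤ L := by
  obtain ⟨τ₀, hτ₀, L₀, hL₀⟩ := exists_strip_bound_of_forall_isRegularPoint h
  set τ : ℝ := min τ₀ (min (t - T₄) (T - t)) with hτ
  have hτpos : 0 < τ := lt_min hτ₀ (lt_min (by linarith [ht.1]) (by linarith [ht.2]))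
  have hτ₁ : τ ≤ τ₀ := min_le_left _ _
  have hτ₂ : τ ≤ t - T₄ := (min_le_right _ _).trans (min_le_left _ _)
  have hτ₃ : τ ≤ T - t := (min_le_right _ _).trans (min_le_right _ _)
  have hsubI : Ioo (t - τ) (t + τ) ⊆ Ioo T₄ T := Ioo_subset_Ioo (by linarith) (by linarith)
  refine ⟨τ, hτpos, hsubI, max L₀ M, ?_⟩
  have hcover : Ioo (t - τ) (t + τ) ×ˢ (univ : Set (EuclideanSpace ℝ (Fin 3))) ⊆
      Ioo (t - τ₀) (t + τ₀) ×ˢ closedBall (0 : EuclideanSpace ℝ (Fin 3)) (R₀ + 1) ∪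
        Ioo T₄ T ×ˢ (closedBall (0 : EuclideanSpace ℝ (Fin 3)) R₀)ᶜ := by
    rintro ⟨s, y⟩ ⟨hs, -⟩
    by_cases hy : y ∈ closedBall (0 : EuclideanSpace ℝ (Fin 3)) (R₀ + 1)
    · exact Or.inl ⟨⟨by linarith [hs.1], by linarith [hs.2]⟩, hy⟩
    · refine Or.inr ⟨hsubI hs, ?_⟩
      rw [mem_compl_iff, mem_closedBall, dist_zero_right, not_le]
      rw [mem_closedBall, dist_zero_right, not_le] at hy
      linarith
  refine ae_restrict_of_ae_restrict_of_subset hcover ?_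
  rw [ae_restrict_union_iff]
  constructor
  · filter_upwards [hL₀] with z hz using hz.trans (le_max_left _ _)
  · filter_upwards [hfar] with z hz using hz.trans (le_max_right _ _)


/-! ### Steps 4–6: the velocity vanishes on a bounded strip whose far-field vorticity vanishes -/

set_option maxHeartbeats 1600000 in
/-- **The interior step** (Escauriaza–Seregin–Šverák 2003, §3 after (3.32) and §5, Thm. 4.1;
Seregin 2012, §4; Seregin 2014, Ch. 7 p. 139): let `(v, π)` be a local Leray solution on the
slab `(0, T) × ℝ³` at unit viscosity with weakly divergence-free datum, essentially bounded on a
strip `(a, b) × ℝ³`, `0 < a < b ≤ T`, and suppose that on `(a, b) × {x₃ > R_f}` it has a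
representative `U_f`, `C¹` in space, with `curl U_f = 0`. Then `v = 0` a.e. on
`((a + b)/2, b) × ℝ³`. Proof: the representative `U` of `v` on the strip with bounded spatial
derivatives up to order `4` (`exists_farField_representative_unit` with an empty excluded ball)
has a vorticity of class `C¹ ∩ {∂ₓω ∈ C¹}` obeying `|∂ₜω - Δω| ≤ 2K(|ω| + |∇ω|)`, vanishing on
the far half-space (it agrees with `curl U_f` there at a.e. time, hence at every time by
continuity); unique continuation across spheres centred deep in the half-space
(`Carleman.uniqueContinuation_uncurried_c12`) makes it vanish identically; the slices of `U` are
then bounded, irrotational and solenoidal, hence constant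
(`eq_of_curl_eq_zero_of_isDivFree_of_bounded`), and the decay of the local Leray class at
spatial infinity forces the constants to vanish for a.e. time.
[cite: EscauriazaSereginSverak2003, §3 after (3.32), Thm. 4.1, §5] [cite: Seregin2012CMP, §4] -/
theorem ae_zero_strip_of_farField_curl_eq_zero
    (hB : NSBoundedHigherRegularityBounds) (hK : kangMiuraTsai_local_pressure_bound)
    {T : ℝ} {u₀ : EuclideanSpace ℝ (Fin 3) → EuclideanSpace ℝ (Fin 3)}
    {v : ℝ → EuclideanSpace ℝ (Fin 3) → EuclideanSpace ℝ (Fin 3)}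
    {π : ℝ → EuclideanSpace ℝ (Fin 3) → ℝ}
    (hdiv : IsWeaklyDivFree u₀) (hv : IsLocalLeraySolutionOn T 1 u₀ v π)
    {a b L : ℝ} (ha : 0 < a) (hab : a < b) (hbT : b ≤ T)
    (hbd : ∀ᵐ z ∂(volume.restrict (Ioo a b ×ˢ (univ : Set (EuclideanSpace ℝ (Fin 3))))),
      ‖v z.1 z.2‖ ≤ L)
    {Rf : ℝ} {Uf : ℝ → EuclideanSpace ℝ (Fin 3) → EuclideanSpace ℝ (Fin 3)}
    (hUf1 : ∀ t ∈ Ioo a b, ContDiffOn ℝ 1 (Uf t) {x : EuclideanSpace ℝ (Fin 3) | Rf < x 2})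
    (hUfv : uncurry Uf =ᵐ[volume.restrict
      (Ioo a b ×ˢ {x : EuclideanSpace ℝ (Fin 3) | Rf < x 2})] uncurry v)
    (hcurl : ∀ t ∈ Ioo a b, ∀ x : EuclideanSpace ℝ (Fin 3), Rf < x 2 → curl (Uf t) x = 0) :
    ∀ᵐ z ∂(volume.restrict (Ioo ((a + b) / 2) b ×ˢ (univ : Set (EuclideanSpace ℝ (Fin 3))))),
      v z.1 z.2 = 0 := by
  set a₁ : ℝ := (a + b) / 2 with ha₁
  have ha₁a : a < a₁ := by rw [ha₁]; linarith
  have ha₁b : a₁ < b := by rw [ha₁]; linarith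
  set I : Set ℝ := Ioo a₁ b with hIdef
  have hIo : IsOpen I := isOpen_Ioo
  have hIsub : I ⊆ Ioo a b := Ioo_subset_Ioo ha₁a.le le_rfl
  set Ω : Set (ℝ × EuclideanSpace ℝ (Fin 3)) := I ×ˢ (univ : Set (EuclideanSpace ℝ (Fin 3)))
    with hΩdef
  have hΩo : IsOpen Ω := hIo.prod isOpen_univ
  -- ### Step 4: the representative on the strip
  have hbd' : eLpNorm (uncurry v) ∞ (volume.restrict
      (Ioo a b ×ˢ (closedBall (0 : EuclideanSpace ℝ (Fin 3)) (-1))ᶜ)) < ∞ := by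
    have e : (closedBall (0 : EuclideanSpace ℝ (Fin 3)) (-1 : ℝ))ᶜ = univ := by
      rw [Metric.closedBall_eq_empty.2 (by norm_num), compl_empty]
    rw [e, eLpNorm_exponent_top]
    exact eLpNormEssSup_lt_top_of_ae_bound hbd
  obtain ⟨K, U, hUv, hUc, hCD, hjc, hbdK⟩ := exists_farField_representative_unit hB hK hdiv hv
    (t₁ := a) (t₂ := b) (R₀ := -1) ha hbT hbd' (T₄ := a₁) (R := -1 / 2) ha₁a ha₁b
    (by norm_num) 4
  have eU : (closedBall (0 : EuclideanSpace ℝ (Fin 3)) (-1 / 2 : ℝ))ᶜ = univ := by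
    rw [Metric.closedBall_eq_empty.2 (by norm_num), compl_empty]
  rw [eU] at hUv hUc hCD hjc hbdK
  -- the equations hold for the representative on the open strip
  have hΩslab : (⟨Ω, hΩo⟩ : Opens (ℝ × EuclideanSpace ℝ (Fin 3))) ≤
      slab (EuclideanSpace ℝ (Fin 3)) (Ioo 0 T) isOpen_Ioo := by
    intro z hz
    rw [mem_slab]
    have hz' : z ∈ Ω := hz
    exact ⟨(ha.trans ha₁a).trans hz'.1.1, hz'.1.2.trans_le hbT⟩
  have hsolv : IsDistributionalNSSolutionOn ⟨Ω, hΩo⟩ 1 0 v π := hv.distributional.of_le hΩslab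
  have hsol : IsDistributionalNSSolutionOn ⟨Ω, hΩo⟩ 1 0 U π :=
    hsolv.congr_ae (hUv.mono fun z hz => hz.symm) (ae_of_all _ fun _ => rfl)
  have hU4 : ∀ t ∈ I, ContDiffOn ℝ 4 (U t) (univ : Set (EuclideanSpace ℝ (Fin 3))) :=
    fun t ht x _ => ((hCD (t, x) ⟨ht, mem_univ _⟩).of_le (by norm_cast)).contDiffWithinAt
  have hΦ : ∀ n ≤ 4, ContinuousOn
      (fun z : ℝ × EuclideanSpace ℝ (Fin 3) => iteratedFDeriv ℝ n (U z.1) z.2) Ω := fun n _ => hjc n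
  have hK₀ : ∀ z ∈ Ω, ‖U z.1 z.2‖ ≤ K := fun z hz => by
    have h := hbdK 0 (by norm_num) z hz
    rwa [norm_iteratedFDeriv_zero] at h
  have hK₁ : ∀ z ∈ Ω, ‖fderiv ℝ (U z.1) z.2‖ ≤ K := fun z hz => by
    have h := hbdK 1 (by norm_num) z hz
    rwa [norm_iteratedFDeriv_one] at h
  -- ### the vorticity: class `C¹₂`, equation, far-field vanishing
  obtain ⟨hdivU, -, -, hω1, hωx⟩ :=
    vorticity_c12_of_isDistributionalNSSolutionOn hIo isOpen_univ hsol hU4 hΦ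
  obtain ⟨-, -, hineq⟩ := vorticity_carleman_inequality hIo isOpen_univ hsol hU4 hΦ hK₀ hK₁
  have hωbd : ∀ z ∈ Ω, ‖(uncurry (vorticity U)) z‖ ≤ ‖curlCLM‖ * K := fun z hz => by
    show ‖vorticity U z.1 z.2‖ ≤ _
    rw [vorticity_apply]
    exact (norm_curl_le _ _).trans
      (mul_le_mul_of_nonneg_left (hK₁ z hz) (ContinuousLinearMap.opNorm_nonneg curlCLM))
  set H : Set (EuclideanSpace ℝ (Fin 3)) := {x : EuclideanSpace ℝ (Fin 3) | Rf < x 2} with hHdef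
  have hHo : IsOpen H := isOpen_setOf_lt_coord Rf
  have hfarΩ : ∀ t ∈ I, ∀ x ∈ H, vorticity U t x = 0 := by
    -- at a.e. `t ∈ I` the slices of `U` and `U_f` agree on `H`
    have h1 : uncurry U =ᵐ[volume.restrict (I ×ˢ H)] uncurry Uf := by
      have hα : uncurry U =ᵐ[volume.restrict (I ×ˢ H)] uncurry v :=
        ae_restrict_of_ae_restrict_of_subset (prod_mono Subset.rfl (subset_univ _)) hUv
      have hβ : uncurry Uf =ᵐ[volume.restrict (I ×ˢ H)] uncurry v :=
        ae_restrict_of_ae_restrict_of_subset (prod_mono hIsub Subset.rfl) hUfv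
      exact hα.trans hβ.symm
    have h2 : ∀ᵐ t ∂(volume.restrict I), U t =ᵐ[volume.restrict H] Uf t :=
      ae_slice_eq_of_ae_eq_prod h1
    have hae : ∀ᵐ t ∂(volume.restrict I), ∀ x ∈ H, vorticity U t x = 0 := by
      filter_upwards [h2, ae_restrict_mem measurableSet_Ioo] with t ht htI x hx
      have hUtc : ContinuousOn (U t) H := fun y _ =>
        (hCD (t, y) ⟨htI, mem_univ _⟩).continuousAt.continuousWithinAt
      have hUftc : ContinuousOn (Uf t) H := (hUf1 t (hIsub htI)).continuousOn
      have heq : EqOn (U t) (Uf t) H := Measure.eqOn_open_of_ae_eq ht hHo hUtc hUftc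
      have hev : U t =ᶠ[𝓝 x] Uf t := Filter.eventuallyEq_of_mem (hHo.mem_nhds hx) heq
      rw [vorticity_apply, curl_eq_curlCLM, hev.fderiv_eq, ← curl_eq_curlCLM]
      exact hcurl t (hIsub htI) x hx
    -- at every `t ∈ I`, by continuity of the vorticity in time
    intro t ht x hx
    have hmaps : MapsTo (fun s : ℝ => ((s, x) : ℝ × EuclideanSpace ℝ (Fin 3))) I Ω :=
      fun s hs => ⟨hs, mem_univ _⟩
    have hcont : ContinuousOn (fun s => vorticity U s x) I :=
      hω1.continuousOn.comp (continuousOn_id.prodMk continuousOn_const) hmaps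
    have hae' : ∀ᵐ s ∂(volume.restrict I), vorticity U s x = 0 := hae.mono fun s hs => hs x hx
    exact forall_eq_zero_of_ae_restrict_Ioo_of_continuousOn hcont hae' t ht
  -- ### Step 5: unique continuation across spheres centred deep in the half-space
  have hωzero : ∀ t ∈ I, ∀ x : EuclideanSpace ℝ (Fin 3), vorticity U t x = 0 := by
    intro t ht x
    have hK0 : 0 ≤ K := (norm_nonneg _).trans (hK₀ (t, 0) ⟨ht, mem_univ _⟩)
    set e₀ : EuclideanSpace ℝ (Fin 3) := EuclideanSpace.basisFun (Fin 3) ℝ 2 with he₀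
    have he₀2 : e₀ 2 = 1 := by
      rw [he₀, EuclideanSpace.basisFun_apply]
      simp
    set x₁ : EuclideanSpace ℝ (Fin 3) := (Rf + 3) • e₀ with hx₁
    have hx₁2 : x₁ 2 = Rf + 3 := by
      rw [hx₁]
      show (Rf + 3) * e₀ 2 = Rf + 3
      rw [he₀2, mul_one]
    have hx₁n : ‖x₁‖ = |Rf + 3| := by
      have he₀n : ‖e₀‖ = 1 := (EuclideanSpace.basisFun (Fin 3) ℝ).orthonormal.1 2
      rw [hx₁, norm_smul, he₀n, mul_one, Real.norm_eq_abs]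
    set Rb : ℝ := ‖x‖ + |Rf + 3| + 10 with hRb
    have hRbpos : 0 < Rb := by positivity
    set T' : ℝ := t - a₁ with hT'
    have hT'pos : 0 < T' := by have := ht.1; simp only [hT']; linarith
    -- the affine map `A(s, y) = (t - s, x₁ + y)`
    set A : ℝ × EuclideanSpace ℝ (Fin 3) → ℝ × EuclideanSpace ℝ (Fin 3) :=
      stAffine (-1) 1 t x₁ with hAdef
    have hA1 : ∀ z : ℝ × EuclideanSpace ℝ (Fin 3), (A z).1 = t - z.1 := fun z => by
      show t + (-1) * z.1 = t - z.1; ring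
    have hA2 : ∀ z : ℝ × EuclideanSpace ℝ (Fin 3), (A z).2 = x₁ + z.2 := fun z => by
      show x₁ + (1 : ℝ) • z.2 = x₁ + z.2; rw [one_smul]
    set Q' : Set (ℝ × EuclideanSpace ℝ (Fin 3)) :=
      Ioo (0 : ℝ) T' ×ˢ ball (0 : EuclideanSpace ℝ (Fin 3)) Rb with hQ'
    have hAΩ' : ∀ z ∈ Ico (0 : ℝ) T' ×ˢ ball (0 : EuclideanSpace ℝ (Fin 3)) Rb, A z ∈ Ω := by
      rintro ⟨s, y⟩ ⟨hs, -⟩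
      refine ⟨?_, mem_univ _⟩
      rw [hA1]
      have h1 := hs.1
      have h2 := hs.2
      simp only [hT'] at h2
      exact ⟨by simp only; linarith, by simp only; linarith [ht.2]⟩
    have hAΩ : ∀ z ∈ Q', A z ∈ Ω := fun z hz => hAΩ' z ⟨Ioo_subset_Ico_self hz.1, hz.2⟩
    -- the transported vorticity
    set ω : ℝ × EuclideanSpace ℝ (Fin 3) → EuclideanSpace ℝ (Fin 3) := uncurry (vorticity U)
      with hωdef
    set u : ℝ × EuclideanSpace ℝ (Fin 3) → EuclideanSpace ℝ (Fin 3) := fun z => ω (A z) with hudef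
    have hu1 : ContDiffOn ℝ 1 u Q' :=
      (Carleman.contDiffOn_comp_stAffine hω1 (-1) 1 t x₁).mono fun z hz => hAΩ z hz
    have hdxu : ∀ e : EuclideanSpace ℝ (Fin 3),
        Carleman.dx e u = fun z => Carleman.dx e ω (A z) := by
      intro e
      funext z
      rw [hudef, Carleman.dx_comp_stAffine (by norm_num) one_ne_zero ω e z, one_smul]
    have hux : ∀ e : EuclideanSpace ℝ (Fin 3), ContDiffOn ℝ 1 (Carleman.dx e u) Q' := by
      intro e
      rw [hdxu e]
      exact (Carleman.contDiffOn_comp_stAffine (hωx e) (-1) 1 t x₁).mono fun z hz => hAΩ z hz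
    have hucont : ContinuousOn u (Ico (0 : ℝ) T' ×ˢ ball (0 : EuclideanSpace ℝ (Fin 3)) Rb) :=
      (Carleman.continuousOn_comp_stAffine hω1.continuousOn (-1) 1 t x₁).mono fun z hz => hAΩ' z hz
    have hdtu : ∀ z, Carleman.dt u z = (-1 : ℝ) • Carleman.dt ω (A z) := fun z => by
      rw [hudef, Carleman.dt_comp_stAffine (by norm_num) one_ne_zero]
    have hlapu : ∀ z, Carleman.lap u z = Carleman.lap ω (A z) := fun z => by
      rw [hudef, Carleman.lap_comp_stAffine (by norm_num) one_ne_zero, one_pow, one_smul]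
    have hgradu : ∀ z, Carleman.gradSq u z = Carleman.gradSq ω (A z) := fun z => by
      rw [hudef, Carleman.gradSq_comp_stAffine (by norm_num) one_ne_zero, one_pow, one_mul]
    have hinequ : ∀ z ∈ Q', ‖Carleman.dt u z + Carleman.lap u z‖ ≤
        (K + K) * (‖u z‖ + Real.sqrt (Carleman.gradSq u z)) := by
      intro z hz
      rw [hdtu z, hlapu z, hgradu z]
      have e1 : (-1 : ℝ) • Carleman.dt ω (A z) + Carleman.lap ω (A z) =
          -(Carleman.dt ω (A z) - Carleman.lap ω (A z)) := by
        rw [neg_one_smul]; abel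
      rw [e1, norm_neg]
      exact hineq (A z) (hAΩ z hz)
    have hvan : ∀ k : ℕ, ∃ C : ℝ, ∀ z ∈ Q', ‖u z‖ ≤ C * (‖z.2‖ + Real.sqrt z.1) ^ k := by
      intro k
      refine ⟨‖curlCLM‖ * K, fun z hz => ?_⟩
      have hbase : 0 ≤ ‖z.2‖ + Real.sqrt z.1 := by positivity
      by_cases hy : ‖z.2‖ < 2
      · -- near the apex the transported vorticity vanishes: the apex ball lies in the half-space
        have hfar' : x₁ + z.2 ∈ H := by
          show Rf < (x₁ + z.2) 2
          have h1 : (x₁ + z.2) 2 = x₁ 2 + z.2 2 := rfl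
          have h2 : |z.2 2| ≤ ‖z.2‖ := by
            have h := PiLp.norm_apply_le z.2 2
            rwa [Real.norm_eq_abs] at h
          rw [h1, hx₁2]
          have h3 := (abs_lt.1 (lt_of_le_of_lt h2 hy)).1
          linarith
        have h0 : u z = 0 := by
          have h := hfarΩ (A z).1 (hAΩ z hz).1 (A z).2 (by rw [hA2]; exact hfar')
          show ω (A z) = 0
          exact h
        rw [h0, norm_zero]
        positivity
      · push Not at hy
        have h1 : (1 : ℝ) ≤ (‖z.2‖ + Real.sqrt z.1) ^ k :=
          one_le_pow₀ (by linarith [Real.sqrt_nonneg z.1])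
        calc ‖u z‖ = ‖ω (A z)‖ := rfl
          _ ≤ ‖curlCLM‖ * K := hωbd _ (hAΩ z hz)
          _ = ‖curlCLM‖ * K * 1 := (mul_one _).symm
          _ ≤ ‖curlCLM‖ * K * (‖z.2‖ + Real.sqrt z.1) ^ k :=
              mul_le_mul_of_nonneg_left h1 (by positivity)
    have huc := Carleman.uniqueContinuation_uncurried_c12 3 3 (c₁ := K + K) (R := Rb) (T := T')
      (by positivity) hRbpos hT'pos hu1 hux hucont hinequ hvan
    -- evaluate at `y = x - x₁`
    have hy : x - x₁ ∈ ball (0 : EuclideanSpace ℝ (Fin 3)) Rb := by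
      rw [mem_ball_zero_iff]
      calc ‖x - x₁‖ ≤ ‖x‖ + ‖x₁‖ := norm_sub_le _ _
        _ < Rb := by rw [hx₁n, hRb]; linarith
    have h := huc (x - x₁) hy
    have hA0 : A (0, x - x₁) = (t, x) := by
      show (t + (-1) * (0 : ℝ), x₁ + (1 : ℝ) • (x - x₁)) = (t, x)
      simp
    have h' : ω (A (0, x - x₁)) = 0 := h
    rw [hA0] at h'
    exact h'
  -- ### Step 6: the slices are constant, and the constants vanish
  have hconst : ∀ t ∈ I, ∀ x : EuclideanSpace ℝ (Fin 3), U t x = U t 0 := by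
    intro t ht x
    have hcd : ContDiff ℝ 2 (U t) := contDiff_iff_contDiffAt.2 fun y =>
      (hCD (t, y) ⟨ht, mem_univ _⟩).of_le (by norm_cast)
    exact eq_of_curl_eq_zero_of_isDivFree_of_bounded hcd
      (fun y => by rw [← vorticity_apply]; exact hωzero t ht y)
      (fun y => hdivU (t, y) ⟨ht, mem_univ _⟩)
      (fun y => hK₀ (t, y) ⟨ht, mem_univ _⟩) x 0
  -- the function `c(t) = U(t, 0)` and its square integral on `I`
  have hc_cont : ContinuousOn (fun s => U s 0) I := by
    have hmaps : MapsTo (fun s : ℝ => ((s, (0 : EuclideanSpace ℝ (Fin 3))) :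
        ℝ × EuclideanSpace ℝ (Fin 3))) I Ω := fun s hs => ⟨hs, mem_univ _⟩
    exact hUc.comp (continuousOn_id.prodMk continuousOn_const) hmaps
  have hc_meas : AEMeasurable (fun s => ‖U s 0‖ₑ ^ 2) (volume.restrict I) :=
    ((hc_cont.aestronglyMeasurable measurableSet_Ioo).aemeasurable.enorm.pow_const 2)
  set C₀ : ℝ≥0∞ := ∫⁻ s in I, ‖U s 0‖ₑ ^ 2 with hC₀
  have hkey : ∀ x₀ : EuclideanSpace ℝ (Fin 3),
      C₀ * volume (ball (0 : EuclideanSpace ℝ (Fin 3)) 1) ≤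
        ∫⁻ z in Ioo 0 T ×ˢ ball x₀ 1, ‖v z.1 z.2‖ₑ ^ 2 := by
    intro x₀
    have hsub : I ×ˢ ball x₀ 1 ⊆ Ioo 0 T ×ˢ ball x₀ 1 :=
      prod_mono (fun s hs => ⟨(ha.trans ha₁a).trans hs.1, hs.2.trans_le hbT⟩) Subset.rfl
    have e1 : ∫⁻ z in I ×ˢ ball x₀ 1, ‖U z.1 0‖ₑ ^ 2 = C₀ * volume (ball x₀ 1) := by
      rw [Measure.volume_eq_prod, ← Measure.prod_restrict]
      have h := lintegral_prod_mul (μ := volume.restrict I) (ν := volume.restrict (ball x₀ 1))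
        (f := fun s => ‖U s 0‖ₑ ^ 2) (g := fun _ => (1 : ℝ≥0∞)) hc_meas aemeasurable_const
      simp only [mul_one, lintegral_const, Measure.restrict_apply MeasurableSet.univ, univ_inter,
        one_mul] at h
      exact h
    have e2 : ∫⁻ z in I ×ˢ ball x₀ 1, ‖v z.1 z.2‖ₑ ^ 2 = ∫⁻ z in I ×ˢ ball x₀ 1, ‖U z.1 0‖ₑ ^ 2 := by
      refine lintegral_congr_ae ?_
      have h1 : ∀ᵐ z ∂(volume.restrict (I ×ˢ ball x₀ 1)), uncurry U z = uncurry v z :=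
        ae_restrict_of_ae_restrict_of_subset (prod_mono Subset.rfl (subset_univ _)) hUv
      filter_upwards [h1, ae_restrict_mem (measurableSet_Ioo.prod measurableSet_ball)] with z hz hzI
      have hz' : U z.1 z.2 = v z.1 z.2 := hz
      rw [← hz', hconst z.1 hzI.1 z.2]
    calc C₀ * volume (ball (0 : EuclideanSpace ℝ (Fin 3)) 1)
        = C₀ * volume (ball x₀ 1) := by rw [Measure.addHaar_ball_center volume x₀ 1]
      _ = ∫⁻ z in I ×ˢ ball x₀ 1, ‖v z.1 z.2‖ₑ ^ 2 := by rw [e2, e1]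
      _ ≤ ∫⁻ z in Ioo 0 T ×ˢ ball x₀ 1, ‖v z.1 z.2‖ₑ ^ 2 := lintegral_mono_set hsub
  have hC₀0 : C₀ = 0 := by
    have hlim := hv.decay 1 one_pos
    have hle : C₀ * volume (ball (0 : EuclideanSpace ℝ (Fin 3)) 1) ≤ 0 :=
      ge_of_tendsto hlim (Eventually.of_forall hkey)
    have hball : volume (ball (0 : EuclideanSpace ℝ (Fin 3)) 1) ≠ 0 :=
      (measure_ball_pos volume _ one_pos).ne'
    rcases mul_eq_zero.1 (le_antisymm hle bot_le) with h | h
    · exact h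
    · exact absurd h hball
  have hc0 : ∀ᵐ s ∂(volume.restrict I), U s 0 = 0 := by
    have h := (lintegral_eq_zero_iff' hc_meas).1 (by rw [← hC₀]; exact hC₀0)
    filter_upwards [h] with s hs
    have hs' : ‖U s 0‖ₑ ^ 2 = 0 := hs
    rwa [pow_eq_zero_iff two_ne_zero, enorm_eq_zero] at hs'
  -- ### conclusion: `v = U = c = 0` a.e. on the strip
  have hprod : ∀ᵐ z ∂(volume.restrict Ω), U z.1 0 = 0 := by
    rw [hΩdef, Measure.volume_eq_prod, ← Measure.restrict_prod_eq_prod_univ]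
    exact (Measure.quasiMeasurePreserving_fst (μ := volume.restrict I)
      (ν := (volume : Measure (EuclideanSpace ℝ (Fin 3))))).ae hc0
  filter_upwards [hUv, hprod, ae_restrict_mem (measurableSet_Ioo.prod MeasurableSet.univ)]
    with z hz hz0 hzΩ
  have hz' : U z.1 z.2 = v z.1 z.2 := hz
  rw [← hz', hconst z.1 hzΩ.1 z.2, hz0]


/-! ### Step 7: assembly on the slab -/

/-- **Essential bound as an a.e. bound** (bookkeeping). [folklore] -/
theorem ae_norm_le_toReal_of_eLpNorm_top_lt_top
    {v : ℝ → EuclideanSpace ℝ (Fin 3) → EuclideanSpace ℝ (Fin 3)}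
    {S : Set (ℝ × EuclideanSpace ℝ (Fin 3))}
    (h : eLpNorm (uncurry v) ∞ (volume.restrict S) < ∞) :
    ∀ᵐ z ∂(volume.restrict S), ‖v z.1 z.2‖ ≤ (eLpNorm (uncurry v) ∞ (volume.restrict S)).toReal := by
  have h1 := enorm_ae_le_eLpNormEssSup (uncurry v) (volume.restrict S)
  filter_upwards [h1] with w hw
  rw [← eLpNorm_exponent_top] at hw
  calc ‖v w.1 w.2‖ = (‖uncurry v w‖ₑ).toReal := by simp [uncurry]
    _ ≤ (eLpNorm (uncurry v) ∞ (volume.restrict S)).toReal :=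
        (ENNReal.toReal_le_toReal enorm_ne_top h.ne).2 hw

/-- **Backward uniqueness for slab local Leray solutions with `L³` datum, unit viscosity**
(Lemarié-Rieusset 2016, Thm. 15.4, through the route of Escauriaza–Seregin–Šverák 2003, §5 and
Seregin 2012, §4, see the module docstring): a local Leray solution `(v, π)` on `(0, T) × ℝ³`
at unit viscosity with weakly divergence-free datum `u₀ ∈ L³` whose pairings with test fields tend
to `0` as `t ↑ T` vanishes a.e. on the slab. Steps: far-field vanishing of the vorticity and the
far-field bound (theorems of the tree), a.e. time is regular (CKN), bounded strips around regular
times, `ae_zero_strip_of_farField_curl_eq_zero` on each, and a countable union of strips with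
rational end points. [cite: LemarieRieusset2016, Thm. 15.4 (PDF p. 568)] [cite: EscauriazaSereginSverak2003, §5] [cite: Seregin2012CMP, §4] -/
theorem IsLocalLeraySolutionOn.ae_zero_of_final_vanishing_unit {T : ℝ} (hT : 0 < T)
    {u₀ : EuclideanSpace ℝ (Fin 3) → EuclideanSpace ℝ (Fin 3)}
    {v : ℝ → EuclideanSpace ℝ (Fin 3) → EuclideanSpace ℝ (Fin 3)}
    {π : ℝ → EuclideanSpace ℝ (Fin 3) → ℝ}
    (hu₀ : MemLp u₀ 3 volume) (hdiv : IsWeaklyDivFree u₀) (hv : IsLocalLeraySolutionOn T 1 u₀ v π)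
    (hfinal : ∀ φ : EuclideanSpace ℝ (Fin 3) → EuclideanSpace ℝ (Fin 3),
      FunctionSpaces.IsTestFunctionOn (⊤ : Opens (EuclideanSpace ℝ (Fin 3))) φ →
        Tendsto (fun t => ∫ x, ⟪v t x, φ x⟫) (𝓝[<] T) (𝓝 0)) :
    ∀ᵐ z ∂(volume.restrict (Ioo 0 T ×ˢ (univ : Set (EuclideanSpace ℝ (Fin 3))))),
      v z.1 z.2 = 0 := by
  -- it suffices to treat the slabs `(T₄, T) × ℝ³`, `T₄ = T/(n+2)`
  suffices hmain : ∀ T₄ ∈ Ioo 0 T,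
      ∀ᵐ z ∂(volume.restrict (Ioo T₄ T ×ˢ (univ : Set (EuclideanSpace ℝ (Fin 3))))),
        v z.1 z.2 = 0 by
    have hn : ∀ n : ℕ, ∀ᵐ z ∂(volume.restrict
        (Ioo (T / (n + 2)) T ×ˢ (univ : Set (EuclideanSpace ℝ (Fin 3))))), v z.1 z.2 = 0 :=
      fun n => hmain _ ⟨by positivity, div_lt_self hT (by norm_cast; omega)⟩
    have hU : Ioo 0 T ×ˢ (univ : Set (EuclideanSpace ℝ (Fin 3))) =
        ⋃ n : ℕ, Ioo (T / (n + 2)) T ×ˢ (univ : Set (EuclideanSpace ℝ (Fin 3))) := by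
      ext ⟨t, x⟩
      simp only [mem_prod, mem_Ioo, mem_univ, and_true, mem_iUnion]
      constructor
      · rintro ⟨ht0, htT⟩
        obtain ⟨n, hn⟩ := exists_nat_gt (T / t)
        refine ⟨n, ?_, htT⟩
        have h1 : T < (n : ℝ) * t := (div_lt_iff₀ ht0).1 hn
        rw [div_lt_iff₀ (by positivity)]
        nlinarith
      · rintro ⟨n, h1, h2⟩
        exact ⟨lt_trans (by positivity) h1, h2⟩
    rw [hU, ae_restrict_iUnion_iff]
    exact hn
  intro T₄ hT₄
  have hI₄ : Ioo T₄ T ⊆ Ioo 0 T := Ioo_subset_Ioo hT₄.1.le le_rfl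
  -- ### the far field: vanishing vorticity (Steps 2–3 of the printed proof) and the `L^∞` bound
  obtain ⟨Rf, Uf, hUf1, hUfv, hcurl⟩ :=
    localLeray_farField_vorticity_eq_zero_slab_of_higherRegularityBounds
      NSBoundedHigherRegularityBounds_holds one_pos hT hu₀ hdiv hv hfinal T₄ hT₄
  obtain ⟨Rb, hRb⟩ :=
    leray_solution_farField_bound_slab_holds T u₀ hu₀ hdiv v π hv T₄ T hT₄.1 hT₄.2 le_rfl
  have hfar := ae_norm_le_toReal_of_eLpNorm_top_lt_top hRb
  -- ### a.e. time is regular; around each regular time a strip where `v` vanishes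
  have hreg : ∀ᵐ t ∂(volume.restrict (Ioo T₄ T)), ∀ x : EuclideanSpace ℝ (Fin 3),
      IsRegularPoint v (t, x) :=
    ae_restrict_of_ae_restrict_of_subset hI₄ (ae_forall_isRegularPoint_slab one_pos hv.suitable)
  have hstrip : ∀ᵐ t ∂(volume.restrict (Ioo T₄ T)), ∃ q : ℚ × ℚ, t ∈ Ioo (q.1 : ℝ) q.2 ∧
      ∀ᵐ z ∂(volume.restrict (Ioo (q.1 : ℝ) q.2 ×ˢ (univ : Set (EuclideanSpace ℝ (Fin 3))))),
        v z.1 z.2 = 0 := by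
    filter_upwards [hreg, ae_restrict_mem measurableSet_Ioo] with t ht htI
    obtain ⟨τ, hτ, hsubτ, L, hL⟩ := exists_strip_bound_Ioo hfar (fun x _ => ht x) htI
    obtain ⟨h1, h2⟩ := (Ioo_subset_Ioo_iff (by linarith : t - τ < t + τ)).1 hsubτ
    -- the strip lemma on `(t - τ, t + τ/2)`, which vanishes on `(t - τ/4, t + τ/2) ∋ t`
    have ha : 0 < t - τ := lt_of_lt_of_le hT₄.1 h1
    have hab : t - τ < t + τ / 2 := by linarith
    have hbT : t + τ / 2 ≤ T := by linarith
    have hJ : Ioo (t - τ) (t + τ / 2) ⊆ Ioo T₄ T := Ioo_subset_Ioo h1 (by linarith)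
    have hbd : ∀ᵐ z ∂(volume.restrict
        (Ioo (t - τ) (t + τ / 2) ×ˢ (univ : Set (EuclideanSpace ℝ (Fin 3))))), ‖v z.1 z.2‖ ≤ L :=
      ae_restrict_of_ae_restrict_of_subset
        (prod_mono (Ioo_subset_Ioo le_rfl (by linarith)) Subset.rfl) hL
    have hz := ae_zero_strip_of_farField_curl_eq_zero NSBoundedHigherRegularityBounds_holds
      kangMiuraTsai_local_pressure_bound_holds hdiv hv ha hab hbT hbd
      (fun s hs => hUf1 s (hJ hs))
      (ae_restrict_of_ae_restrict_of_subset (prod_mono hJ Subset.rfl) hUfv)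
      (fun s hs x hx => hcurl s (hJ hs) x hx)
    obtain ⟨q₁, hq₁a, hq₁t⟩ := exists_rat_btwn (show t - τ / 4 < t by linarith)
    obtain ⟨q₂, hq₂t, hq₂b⟩ := exists_rat_btwn (show t < t + τ / 2 by linarith)
    refine ⟨(q₁, q₂), ⟨hq₁t, hq₂t⟩, ae_restrict_of_ae_restrict_of_subset (prod_mono
      (Ioo_subset_Ioo (by linarith) hq₂b.le) Subset.rfl) hz⟩
  -- ### the countable union of the good rational strips carries a.e. every time
  set G : Set (ℚ × ℚ) := {q | ∀ᵐ z ∂(volume.restrict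
    (Ioo (q.1 : ℝ) q.2 ×ˢ (univ : Set (EuclideanSpace ℝ (Fin 3))))), v z.1 z.2 = 0} with hG
  set S : Set ℝ := ⋃ q ∈ G, Ioo (q.1 : ℝ) q.2 with hSdef
  have hS : ∀ᵐ z ∂(volume.restrict (S ×ˢ (univ : Set (EuclideanSpace ℝ (Fin 3))))),
      v z.1 z.2 = 0 := by
    have e : S ×ˢ (univ : Set (EuclideanSpace ℝ (Fin 3))) =
        ⋃ q ∈ G, Ioo (q.1 : ℝ) q.2 ×ˢ (univ : Set (EuclideanSpace ℝ (Fin 3))) := by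
      rw [hSdef]
      simp only [iUnion_prod_const]
    rw [e, ae_restrict_biUnion_iff _ (Set.to_countable G)]
    exact fun q hq => hq
  have hnull : volume (Ioo T₄ T \ S) = 0 := by
    refine measure_eq_zero_iff_ae_notMem.2 ?_
    have h := (ae_restrict_iff' measurableSet_Ioo).1 hstrip
    filter_upwards [h] with t ht hmem
    obtain ⟨q, hq, hqG⟩ := ht hmem.1
    exact hmem.2 (mem_iUnion₂.2 ⟨q, hqG, hq⟩)
  -- ### conclusion
  have hcover : Ioo T₄ T ×ˢ (univ : Set (EuclideanSpace ℝ (Fin 3))) ⊆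
      S ×ˢ (univ : Set (EuclideanSpace ℝ (Fin 3))) ∪
        (Ioo T₄ T \ S) ×ˢ (univ : Set (EuclideanSpace ℝ (Fin 3))) := by
    rintro ⟨t, x⟩ ⟨ht, -⟩
    by_cases hts : t ∈ S
    · exact Or.inl ⟨hts, mem_univ _⟩
    · exact Or.inr ⟨⟨ht, hts⟩, mem_univ _⟩
  refine ae_restrict_of_ae_restrict_of_subset hcover ?_
  rw [ae_restrict_union_iff]
  refine ⟨hS, ?_⟩
  have h0 : volume ((Ioo T₄ T \ S) ×ˢ (univ : Set (EuclideanSpace ℝ (Fin 3)))) = 0 := by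
    rw [Measure.volume_eq_prod, Measure.prod_prod, hnull, zero_mul]
  rw [Measure.restrict_eq_zero.2 h0, ae_zero]
  exact eventually_bot

/-- **Backward uniqueness for slab local Leray solutions with `L³` datum, viscosity `ν > 0`**
(Lemarié-Rieusset 2016, Thm. 15.4), from the unit-viscosity theorem by the scaling `t ↦ νt` of
the slab class (`IsLocalLeraySolutionOn.toUnitViscosity`; the final-value hypothesis and the
a.e. conclusion transport along `ae_restrict_preimage_stAffine`).
[cite: LemarieRieusset2016, Thm. 15.4 (PDF p. 568)] [cite: RusinSverak2011, §1 (unit viscosity)] -/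
theorem IsLocalLeraySolutionOn.ae_zero_of_final_vanishing {ν T : ℝ} (hν : 0 < ν) (hT : 0 < T)
    {u₀ : EuclideanSpace ℝ (Fin 3) → EuclideanSpace ℝ (Fin 3)}
    {v : ℝ → EuclideanSpace ℝ (Fin 3) → EuclideanSpace ℝ (Fin 3)}
    {π : ℝ → EuclideanSpace ℝ (Fin 3) → ℝ}
    (hu₀ : MemLp u₀ 3 volume) (hdiv : IsWeaklyDivFree u₀) (hv : IsLocalLeraySolutionOn T ν u₀ v π)
    (hfinal : ∀ φ : EuclideanSpace ℝ (Fin 3) → EuclideanSpace ℝ (Fin 3),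
      FunctionSpaces.IsTestFunctionOn (⊤ : Opens (EuclideanSpace ℝ (Fin 3))) φ →
        Tendsto (fun t => ∫ x, ⟪v t x, φ x⟫) (𝓝[<] T) (𝓝 0)) :
    ∀ᵐ z ∂(volume.restrict (Ioo 0 T ×ˢ (univ : Set (EuclideanSpace ℝ (Fin 3))))),
      v z.1 z.2 = 0 := by
  have hw := hv.toUnitViscosity hν
  have hu₀' : MemLp (ν⁻¹ • u₀) 3 volume := hu₀.const_smul _
  have hdiv' : IsWeaklyDivFree (ν⁻¹ • u₀) := hdiv.const_smul _
  have hνT : 0 < ν * T := mul_pos hν hT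
  -- the final-value hypothesis for the normalised solution
  have hfinal' : ∀ φ : EuclideanSpace ℝ (Fin 3) → EuclideanSpace ℝ (Fin 3),
      FunctionSpaces.IsTestFunctionOn (⊤ : Opens (EuclideanSpace ℝ (Fin 3))) φ →
        Tendsto (fun s => ∫ x, ⟪FluidPDE.timeRescale ν⁻¹ ν⁻¹ v s x, φ x⟫)
          (𝓝[<] (ν * T)) (𝓝 0) := by
    intro φ hφ
    have e : (fun s => ∫ x, ⟪FluidPDE.timeRescale ν⁻¹ ν⁻¹ v s x, φ x⟫) =
        fun s => ν⁻¹ * ∫ x, ⟪v (ν⁻¹ * s) x, φ x⟫ := by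
      funext s
      simp only [timeRescale_apply, real_inner_smul_left]
      exact integral_const_mul _ _
    rw [e]
    have hmap : Tendsto (fun s : ℝ => ν⁻¹ * s) (𝓝[<] (ν * T)) (𝓝[<] T) := by
      have hc : ContinuousWithinAt (fun s : ℝ => ν⁻¹ * s) (Iio (ν * T)) (ν * T) :=
        (continuous_const.mul continuous_id).continuousWithinAt
      have hm : MapsTo (fun s : ℝ => ν⁻¹ * s) (Iio (ν * T)) (Iio T) := by
        intro s hs
        have h : ν⁻¹ * s < ν⁻¹ * (ν * T) := mul_lt_mul_of_pos_left hs (inv_pos.2 hν)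
        rwa [← mul_assoc, inv_mul_cancel₀ hν.ne', one_mul] at h
      have h := hc.tendsto_nhdsWithin hm
      rwa [← mul_assoc, inv_mul_cancel₀ hν.ne', one_mul] at h
    have h := ((hfinal φ hφ).comp hmap).const_mul ν⁻¹
    rw [mul_zero] at h
    exact h
  have h := IsLocalLeraySolutionOn.ae_zero_of_final_vanishing_unit hνT hu₀' hdiv' hw hfinal'
  -- transport back along `(t, x) ↦ (ν t, x)`
  have h2 := ae_restrict_preimage_stAffine hν one_pos 0 (0 : EuclideanSpace ℝ (Fin 3)) h
  rw [stAffine_preimage_Ioo_zero_prod hν T] at h2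
  filter_upwards [h2] with z hz
  have hz' : ν⁻¹ • v (ν⁻¹ * (0 + ν * z.1)) (0 + (1 : ℝ) • z.2) = 0 := hz
  rw [zero_add, zero_add, one_smul, ← mul_assoc, inv_mul_cancel₀ hν.ne', one_mul] at hz'
  exact (smul_eq_zero.1 hz').resolve_left (inv_ne_zero hν.ne')

/-! ### The discharges -/

/-- **Discharge of `lemarieRieusset_backward_uniqueness_slab`** (Lemarié-Rieusset 2016,
Thm. 15.4, PDF p. 568, on a slab: a local Leray solution on `(0, T) × ℝ³` with weakly
divergence-free datum `u₀ ∈ L³` whose value at the final time vanishes in the sense of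
distributions vanishes a.e.), by `IsLocalLeraySolutionOn.ae_zero_of_final_vanishing` — the printed
theorem proved along Escauriaza–Seregin–Šverák 2003, §5 / Seregin 2012, §4 (far-field backward
uniqueness, CKN regular times, unique continuation, Liouville) instead of through the weak–strong
uniqueness theorem of Step 1 of the printed proof. Net effect on the tree: the named fact
`local_leray_weak_strong_uniqueness` (Thm. 14.7) leaves the trust base of Thm. 15.4.
[cite: LemarieRieusset2016, Thm. 15.4, p. 568 (proof pp. 568–569)] [cite: EscauriazaSereginSverak2003, §5] [cite: Seregin2012CMP, §4] -/
theorem lemarieRieusset_backward_uniqueness_slab_holds : lemarieRieusset_backward_uniqueness_slab := by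
  intro ν T hν hT u₀ v π hu₀ hdiv hv hfinal
  exact IsLocalLeraySolutionOn.ae_zero_of_final_vanishing hν hT hu₀ hdiv hv hfinal

/-- **Discharge of `lemarieRieusset_backward_uniqueness`** (Lemarié-Rieusset 2016, Thm. 15.4, in
Jia–Šverák's global class, `NSLerayHopfSereginLiminf.lean`): the accepted
`lemarieRieusset_backward_uniqueness_of_slab` applied to `lemarieRieusset_backward_uniqueness_slab_holds`.
[cite: LemarieRieusset2016, Thm. 15.4, p. 568] -/
theorem lemarieRieusset_backward_uniqueness_holds : lemarieRieusset_backward_uniqueness :=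
  lemarieRieusset_backward_uniqueness_of_slab lemarieRieusset_backward_uniqueness_slab_holds

end Literature.Analysis.FluidPDE

end
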